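import Summits.QuantumFields.YangMills.Theorems.SwapVirialDeficitSectorLaplaceMbDensityDetFolRescaled
import Summits.QuantumFields.YangMills.Theorems.SwapVirialDeficitBlowUpGnomonicFollowerHessianAngle
import Summits.QuantumFields.YangMills.Theorems.SwapVirialDeficitBlowUpGnomonicHubAngleLetters
import Summits.QuantumFields.YangMills.Theorems.SwapVirialDeficitBlowUpGnomonicBaseFlat
import Summits.QuantumFields.YangMills.Theorems.SwapVirialDeficitBlowUpChartDeficitZeroSet
import Summits.QuantumFields.YangMills.Theorems.SwapVirialDeficitBlowUpGnomonicBFibreJets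
import Summits.QuantumFields.YangMills.Theorems.SwapVirialDeficitSectorLaplaceBTubeFibredScaled
import HarnessLib

/-!
# STUB (S-end-G♭) OF SKELETON ➎, SHELL SIDE (δ), POINTWISE: base-point coercivity of the follower Hessian and the shell-to-reference comparison of the Morse–Bott density
# (free-hands support of ⟨stmt-QuantumFields-24197⟩ `SwapVirialDeficit.SwapGluedStiffness`; cell ym-idea-1, LEAD g99 memo11 §2 (f)(g) ∕ 22:59Z ruling (δ); assembler fcl-p3 g48)

* §1 ★★ `gnoFolHessian_coercive_base` — at every BASE POINT `gnoBase x₀ y₀` of the Morse–Bott bottom and EVERY hub `a ≠ 0` the follower Hessian is `μ_F`-coercive,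
  `μ_F = (2304·L⁶·|Fol L|)⁻¹`, for good sign patterns: the base is exactly flat (w3 ✓`gnoDeficit_base_eq_zero`), so the leader relations vanish EXACTLY
  (✓`chartDeficit_eq_zero_iff`) and w2's ✓`gnoFolHessian_coercive` applies with `s = 0` — THE LEMMA LEAD asked to be named; `det_gnoFolHessian_base_ge` (`μ_F^{d} ≤ det`).
* §2 ★★★ `mbDensity_shell_ge_ref` — for a REFERENCE follower-Hessian family `A′` at the end hub `hubAt 0 1` (symmetric, ambient identity, ray identity) and every shell hub
  `hubAt δ′ 1`, `0 < δ′ ≤ r ≤ r_m(L) := μ_F∕(2·122689728·L⁴)`: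
  `(1+x₀²)⁻¹(1+y₀²)⁻¹ · ((1+d)·20400L⁴)^{−7∕2} · e^{−½} · e^{−3|Fol L|·122689728·r·L⁴∕μ_F} ∕ √det A′(gnoBase x₀ y₀) ≤ 𝔪(hubAt δ′ 1, ε, (x₀, y₀))`
  (w2 ✓`mbDensity_ge_detFol_rescaled′` at the shell hub with its own family ✓`exists_gnoFolHessian`, then the one-loop angle matching ✓`abs_log_det_gnoFolHessian_sub_le_joint`
  through ✓`gnoDeficit_hubAt_eq_angUnit`, ✓`abs_hubAngle_sub_le`, §1 for the coercivity input) — the pointwise heart of the shell side (δ); integrating it against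
  `((1+δ′²)⁻¹)²dδ′` on `Icc (r∕2) r` (✓`endShell_weight_ge`) is the assembly's Tonelli step.

HONEST LABEL: pointwise bookkeeping for the shell side of `stub_end_gaussCore`; the stub itself (N2, slab∕shell comparison, assembly), `stub_core_tip` and hence ⟨24197⟩ ∕ ⟨24194⟩
remain OPEN; item of record ⟨24085⟩ SubOctaveBounded aside ∕ untouched; the Yang–Mills mass gap is NOT proved; no summit is proved by a line.  THEOREMS ONLY (0 `def`, 0 `sorry`),
standard axioms, no instances.  Seat ym-line-fcl-p3 g48 (cell ym-idea-1, free hands), `--supports stmt-QuantumFields-24197`.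
References: [cite: Luscher1983, §2]; [cite: Breitung1994, Lemma 26 (2.102), p. 30]; [cite: tHooft1979]; [folklore].
-/

set_option autoImplicit false
set_option synthInstance.maxSize 1024

noncomputable section

open MeasureTheory Quaternion Set Module
open scoped Quaternion BigOperators ENNReal InnerProductSpace
open Literature.MathematicalPhysics.QuantumLattice
open Literature.MathematicalPhysics.QuantumFieldTheory hiding SU2

namespace Summit.QuantumFields.YangMills.Theorems.SwapVirialDeficit.SectorLaplace

open Summit.QuantumFields.YangMills.Theorems.FemtoTransferGap
open Summit.QuantumFields.YangMills.Theorems.FemtoTransferGap.TT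
open Summit.QuantumFields.YangMills.Theorems.VirialFluxGap.RingDeficit
open Summit.QuantumFields.YangMills.Theorems.SwapVirialDeficit.SwapRing
open Summit.QuantumFields.YangMills.Theorems.SwapVirialDeficit.BlowUpRing

variable {L : ℕ} [NeZero L]

/-! ## §1 Base-point coercivity of the follower Hessian -/

/-- ★★ **THE FOLLOWER HESSIAN IS `μ_F`-COERCIVE AT EVERY BASE POINT, FOR EVERY HUB** (`μ_F = (2304·L⁶·|Fol L|)⁻¹`; good sign patterns): at `η = gnoBase x₀ y₀` the deficit
vanishes (✓`gnoDeficit_base_eq_zero`), so the leader tuple commutes and intertwines the seam EXACTLY (✓`chartDeficit_eq_zero_iff`), and ✓`gnoFolHessian_coercive` applies with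
`s = 0`. [cite: Luscher1983, §2] -/
theorem gnoFolHessian_coercive_base {a : ℍ} (ha : a ≠ 0) (ε : GnoSign L) (hz : ε.2.1 = true) (hF : ε.2.2 = fun _ => true) (x₀ y₀ : ℝ)
    {A : GnoCoord L → GnoFol L →ₗ[ℝ] GnoFol L}
    (hray : ∀ η' (y : GnoFol L), ⟪A η' y, y⟫_ℝ = iteratedDeriv 2 (fun s : ℝ => gnoDeficit (fun _ => false) (fun _ => 1) a ε (η' + s • gnoFolEmb y)) 0)
    (y : GnoFol L) :
    (2304 * (L : ℝ) ^ 6 * (Fintype.card (Fol L) : ℝ))⁻¹ * ‖y‖ ^ 2 ≤ ⟪A (gnoBase x₀ y₀) y, y⟫_ℝ := by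
  have h0 : gnoDeficit (fun _ => false) (fun _ => 1) a ε (gnoBase x₀ y₀ : GnoCoord L) = 0 := gnoDeficit_base_eq_zero ha ε hz hF x₀ y₀
  have h0' : chartDeficit L (fun _ => false) (fun _ => 1) (blowUpPoint 1 (gnomonicPoint a ε (gnoBase x₀ y₀ : GnoCoord L))) = 0 := by
    unfold gnoDeficit at h0; exact h0
  obtain ⟨hCC, hσ, -⟩ := (chartDeficit_eq_zero_iff (L := L) _).1 h0'
  have hL : (0 : ℝ) < L := by exact_mod_cast NeZero.pos L
  exact gnoFolHessian_coercive ha ε hF (gnoBase x₀ y₀) rfl hray le_rfl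
    (fun μ ν => by rw [hCC μ ν, sub_self, frobNorm_zero]) (fun μ => by rw [hσ μ, sub_self, frobNorm_zero])
    (by rw [zero_pow two_ne_zero]; positivity) y

/-- `μ_F^{dim V_F} ≤ det A(gnoBase x₀ y₀)` for a symmetric follower-Hessian family with the ray identity (✓`det_ge_pow_of_coercive`). [cite: Breitung1994, Lemma 26 (2.102), p. 30] -/
theorem det_gnoFolHessian_base_ge {a : ℍ} (ha : a ≠ 0) (ε : GnoSign L) (hz : ε.2.1 = true) (hF : ε.2.2 = fun _ => true) (x₀ y₀ : ℝ)
    {A : GnoCoord L → GnoFol L →ₗ[ℝ] GnoFol L} (hAs : ∀ η, (A η).IsSymmetric)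
    (hray : ∀ η' (y : GnoFol L), ⟪A η' y, y⟫_ℝ = iteratedDeriv 2 (fun s : ℝ => gnoDeficit (fun _ => false) (fun _ => 1) a ε (η' + s • gnoFolEmb y)) 0) :
    ((2304 * (L : ℝ) ^ 6 * (Fintype.card (Fol L) : ℝ))⁻¹) ^ finrank ℝ (GnoFol L) ≤ LinearMap.det (A (gnoBase x₀ y₀)) :=
  det_ge_pow_of_coercive (hAs _) (folMu_pos_le (L := L)).1 (gnoFolHessian_coercive_base ha ε hz hF x₀ y₀ hray)

/-! ## §2 The shell hub against the reference hub, pointwise in the base -/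

/-- `(hubAt δ 1).re = δ` and `hubAt δ 1 ≠ 0`, `(hubAt δ 1).im ≠ 0`. [folklore] -/
theorem hubAt_one_re (δ : ℝ) : (hubAt δ 1).re = δ := by
  rw [hubAt_eq_equator_sub_smul]
  simp [hubAt_zero_one_re]

/-- ★★★ **THE SHELL HUB AGAINST THE REFERENCE HUB, POINTWISE** (good sign patterns).  Let `A′` be a follower-Hessian family at the end hub `hubAt 0 1` (symmetric; ambient
identity; ray identity) and `0 < δ′ ≤ r` with `122689728·r·L⁴ ≤ μ_F∕2`.  Then at every base point
`(1+x₀²)⁻¹(1+y₀²)⁻¹·((1+d)·20400L⁴)^{−7∕2}·e^{−½}·e^{−(3|Fol L|·122689728·r·L⁴)∕μ_F} ∕ √det A′(gnoBase x₀ y₀) ≤ 𝔪(hubAt δ′ 1, ε, (x₀,y₀))`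
(`d = dim V_F`, `μ_F = (2304L⁶|Fol L|)⁻¹`). [cite: Luscher1983, §2] [cite: Breitung1994, Lemma 26 (2.102), p. 30] -/
theorem mbDensity_shell_ge_ref {ε : GnoSign L} (hε : GoodSign ε)
    {A' : GnoCoord L → GnoFol L →ₗ[ℝ] GnoFol L} (hAs' : ∀ η, (A' η).IsSymmetric)
    (hamb' : ∀ η (y : GnoFol L), ⟪A' η y, y⟫_ℝ = iteratedFDeriv ℝ 2 (gnoDeficit (fun _ => false) (fun _ => 1) (hubAt 0 1) ε) η (fun _ => gnoFolEmb y))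
    (hray' : ∀ η' (y : GnoFol L), ⟪A' η' y, y⟫_ℝ = iteratedDeriv 2 (fun s : ℝ => gnoDeficit (fun _ => false) (fun _ => 1) (hubAt 0 1) ε (η' + s • gnoFolEmb y)) 0)
    {r δ' : ℝ} (hδ0 : 0 < δ') (hδr : δ' ≤ r)
    (hr : 122689728 * r * (L : ℝ) ^ 4 ≤ (2304 * (L : ℝ) ^ 6 * (Fintype.card (Fol L) : ℝ))⁻¹ / 2) (p : ℝ × ℝ) :
    (1 + p.1 ^ 2)⁻¹ * (1 + p.2 ^ 2)⁻¹ * (((1 + (finrank ℝ (GnoFol L) : ℝ)) * (20400 * (L : ℝ) ^ 4)) ^ (-(7 / 2 : ℝ)) * Real.exp (-(1 / 2 : ℝ)) *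
        Real.exp (-((3 * (Fintype.card (Fol L) : ℝ)) * (122689728 * r * (L : ℝ) ^ 4) / (2304 * (L : ℝ) ^ 6 * (Fintype.card (Fol L) : ℝ))⁻¹)) /
        Real.sqrt (LinearMap.det (A' (gnoBase p.1 p.2)))) ≤
      mbDensity (L := L) (hubAt δ' 1) ε p := by
  set μ : ℝ := (2304 * (L : ℝ) ^ 6 * (Fintype.card (Fol L) : ℝ))⁻¹ with hμ
  have hμ0 : 0 < μ := (folMu_pos_le (L := L)).1
  have hL : (0 : ℝ) < L := by exact_mod_cast NeZero.pos L
  -- the shell hub and its own family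
  have ha : hubAt δ' 1 ≠ 0 := hubAt_one_ne_zero δ'
  have hre : (hubAt δ' 1).re ≠ 0 := by rw [hubAt_one_re]; exact hδ0.ne'
  have him : (hubAt δ' 1).im ≠ 0 := hubAt_one_im_ne_zero δ'
  obtain ⟨A, hAs, -, hAyy, hray, hamb, -, -⟩ := exists_gnoFolHessian (fun _ => false) (fun _ => (1 : SU2)) ha ε
  have h1 := mbDensity_ge_detFol_rescaled' (L := L) hre him hε p hAs hAyy
  -- determinants are positive at the base point (§1 for both families)
  have hdet : μ ^ finrank ℝ (GnoFol L) ≤ LinearMap.det (A (gnoBase p.1 p.2)) := det_gnoFolHessian_base_ge ha ε hε.1 hε.2 p.1 p.2 hAs hray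
  have hdet' : μ ^ finrank ℝ (GnoFol L) ≤ LinearMap.det (A' (gnoBase p.1 p.2)) := det_gnoFolHessian_base_ge (hubAt_one_ne_zero 0) ε hε.1 hε.2 p.1 p.2 hAs' hray'
  have hdpos : 0 < LinearMap.det (A (gnoBase p.1 p.2)) := lt_of_lt_of_le (by positivity) hdet
  have hdpos' : 0 < LinearMap.det (A' (gnoBase p.1 p.2)) := lt_of_lt_of_le (by positivity) hdet'
  -- the one-loop angle matching between `hubAt δ′ 1 = angUnit θ` and `hubAt 0 1 = angUnit θ′`
  have eθ : gnoDeficit (fun _ => false) (fun _ => (1 : SU2)) (hubAt δ' 1) ε = gnoDeficit (fun _ => false) (fun _ => 1) (angUnit (Real.pi / 2 - Real.arctan δ')) ε :=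
    funext fun η => gnoDeficit_hubAt_eq_angUnit _ _ δ' ε η
  have eθ' : gnoDeficit (fun _ => false) (fun _ => (1 : SU2)) (hubAt 0 1) ε = gnoDeficit (fun _ => false) (fun _ => 1) (angUnit (Real.pi / 2 - Real.arctan 0)) ε :=
    funext fun η => gnoDeficit_hubAt_eq_angUnit _ _ 0 ε η
  have hambθ : ∀ η (y : GnoFol L), ⟪A η y, y⟫_ℝ = iteratedFDeriv ℝ 2 (gnoDeficit (fun _ => false) (fun _ => 1) (angUnit (Real.pi / 2 - Real.arctan δ')) ε) η
      (fun _ => gnoFolEmb y) := fun η y => by rw [← eθ]; exact hamb η y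
  have hambθ' : ∀ η (y : GnoFol L), ⟪A' η y, y⟫_ℝ = iteratedFDeriv ℝ 2 (gnoDeficit (fun _ => false) (fun _ => 1) (angUnit (Real.pi / 2 - Real.arctan 0)) ε) η
      (fun _ => gnoFolEmb y) := fun η y => by rw [← eθ']; exact hamb' η y
  have hθθ : |(Real.pi / 2 - Real.arctan δ') - (Real.pi / 2 - Real.arctan 0)| ≤ r :=
    (abs_hubAngle_sub_le δ' 0).trans (by rw [sub_zero, abs_of_pos hδ0]; exact hδr)
  have hnear : (122689728 * |(Real.pi / 2 - Real.arctan δ') - (Real.pi / 2 - Real.arctan 0)| +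
      44712000 * ‖(gnoBase p.1 p.2 : GnoCoord L) - gnoBase p.1 p.2‖) * (L : ℝ) ^ 4 ≤ μ / 2 := by
    rw [sub_self, norm_zero, mul_zero, add_zero]
    calc 122689728 * |(Real.pi / 2 - Real.arctan δ') - (Real.pi / 2 - Real.arctan 0)| * (L : ℝ) ^ 4 ≤ 122689728 * r * (L : ℝ) ^ 4 := by gcongr
      _ ≤ μ / 2 := hr
  have hlog := abs_log_det_gnoFolHessian_sub_le_joint (fun _ => false) (fun _ => (1 : SU2)) (sin_hubAngle_pos δ').le (sin_hubAngle_pos 0).le ε hAs hAs'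
    hambθ hambθ' hμ0 (gnoFolHessian_coercive_base (hubAt_one_ne_zero 0) ε hε.1 hε.2 p.1 p.2 hray') hnear
  rw [sub_self, norm_zero, mul_zero, add_zero] at hlog
  -- `log det A ≤ log det A′ + K`, `K ≤ 2·3|Fol|·122689728 r L⁴∕μ`
  set K : ℝ := (3 * (Fintype.card (Fol L) : ℝ)) * (122689728 * r * (L : ℝ) ^ 4) / μ with hK
  have hK0 : 0 ≤ K := by
    have hr0 : 0 ≤ r := hδ0.le.trans hδr
    positivity
  have hlogK : Real.log (LinearMap.det (A (gnoBase p.1 p.2))) ≤ Real.log (LinearMap.det (A' (gnoBase p.1 p.2))) + 2 * K := by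
    have h2 := (abs_le.1 hlog).2
    have h3 : 2 * (3 * (Fintype.card (Fol L) : ℝ)) * (122689728 * |(Real.pi / 2 - Real.arctan δ') - (Real.pi / 2 - Real.arctan 0)| * (L : ℝ) ^ 4) / μ ≤ 2 * K := by
      have hc0 : (0 : ℝ) ≤ 3 * (Fintype.card (Fol L) : ℝ) := by positivity
      have hin : 122689728 * |(Real.pi / 2 - Real.arctan δ') - (Real.pi / 2 - Real.arctan 0)| * (L : ℝ) ^ 4 ≤ 122689728 * r * (L : ℝ) ^ 4 := by gcongr
      have e : 2 * (3 * (Fintype.card (Fol L) : ℝ)) * (122689728 * |(Real.pi / 2 - Real.arctan δ') - (Real.pi / 2 - Real.arctan 0)| * (L : ℝ) ^ 4) / μ =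
          2 * ((3 * (Fintype.card (Fol L) : ℝ)) * (122689728 * |(Real.pi / 2 - Real.arctan δ') - (Real.pi / 2 - Real.arctan 0)| * (L : ℝ) ^ 4) / μ) := by ring
      rw [e, hK]
      exact mul_le_mul_of_nonneg_left (div_le_div_of_nonneg_right (mul_le_mul_of_nonneg_left hin hc0) hμ0.le) (by norm_num)
    linarith
  -- hence `√det A ≤ e^{K} √det A′`, i.e. `e^{−K}∕√det A′ ≤ 1∕√det A`
  have hsqrt : Real.sqrt (LinearMap.det (A (gnoBase p.1 p.2))) ≤ Real.exp K * Real.sqrt (LinearMap.det (A' (gnoBase p.1 p.2))) := by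
    have e1 : Real.sqrt (LinearMap.det (A (gnoBase p.1 p.2))) = Real.exp (Real.log (LinearMap.det (A (gnoBase p.1 p.2))) / 2) := by
      rw [Real.sqrt_eq_rpow, Real.rpow_def_of_pos hdpos]; ring_nf
    have e2 : Real.exp K * Real.sqrt (LinearMap.det (A' (gnoBase p.1 p.2))) = Real.exp ((Real.log (LinearMap.det (A' (gnoBase p.1 p.2))) + 2 * K) / 2) := by
      rw [Real.sqrt_eq_rpow, Real.rpow_def_of_pos hdpos', ← Real.exp_add]; ring_nf
    rw [e1, e2, Real.exp_le_exp]
    linarith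
  have hs0 : 0 < Real.sqrt (LinearMap.det (A (gnoBase p.1 p.2))) := Real.sqrt_pos.2 hdpos
  have hs0' : 0 < Real.sqrt (LinearMap.det (A' (gnoBase p.1 p.2))) := Real.sqrt_pos.2 hdpos'
  refine le_trans ?_ h1
  have hw : 0 ≤ (1 + p.1 ^ 2)⁻¹ * (1 + p.2 ^ 2)⁻¹ := by positivity
  refine mul_le_mul_of_nonneg_left ?_ hw
  -- compare the two quotients
  have hc0 : 0 ≤ ((1 + (finrank ℝ (GnoFol L) : ℝ)) * (20400 * (L : ℝ) ^ 4)) ^ (-(7 / 2 : ℝ)) * Real.exp (-(1 / 2 : ℝ)) := by positivity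
  rw [div_le_div_iff₀ hs0' hs0]
  have eK : Real.exp (-((3 * (Fintype.card (Fol L) : ℝ)) * (122689728 * r * (L : ℝ) ^ 4) / (2304 * (L : ℝ) ^ 6 * (Fintype.card (Fol L) : ℝ))⁻¹)) = Real.exp (-K) := by
    rw [hK]
  rw [eK]
  calc ((1 + (finrank ℝ (GnoFol L) : ℝ)) * (20400 * (L : ℝ) ^ 4)) ^ (-(7 / 2 : ℝ)) * Real.exp (-(1 / 2 : ℝ)) * Real.exp (-K) * Real.sqrt (LinearMap.det (A (gnoBase p.1 p.2)))
      ≤ ((1 + (finrank ℝ (GnoFol L) : ℝ)) * (20400 * (L : ℝ) ^ 4)) ^ (-(7 / 2 : ℝ)) * Real.exp (-(1 / 2 : ℝ)) * Real.exp (-K) *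
          (Real.exp K * Real.sqrt (LinearMap.det (A' (gnoBase p.1 p.2)))) := mul_le_mul_of_nonneg_left hsqrt (by positivity)
    _ = ((1 + (finrank ℝ (GnoFol L) : ℝ)) * (20400 * (L : ℝ) ^ 4)) ^ (-(7 / 2 : ℝ)) * Real.exp (-(1 / 2 : ℝ)) * (Real.exp (-K) * Real.exp K) *
          Real.sqrt (LinearMap.det (A' (gnoBase p.1 p.2))) := by ring
    _ = ((1 + (finrank ℝ (GnoFol L) : ℝ)) * (20400 * (L : ℝ) ^ 4)) ^ (-(7 / 2 : ℝ)) * Real.exp (-(1 / 2 : ℝ)) * Real.sqrt (LinearMap.det (A' (gnoBase p.1 p.2))) := by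
        rw [← Real.exp_add, neg_add_cancel, Real.exp_zero, mul_one]

end Summit.QuantumFields.YangMills.Theorems.SwapVirialDeficit.SectorLaplace

end
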